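/-
Copyright: cell `pub-balaban-gaps` (G2), seat ne6 (row NE7b), `prover-pub-balaban-gaps-ne6-g20-0`. Project licence.
-/
import Summits.QuantumFields.BalabanUV.T4Continuum.Spine.NE7b.CompactFibreMeanActionSUNDeriv

/-!
# THE ONE-PLAQUETTE FREE ENERGY IS STRICTLY CONCAVE AND THE TILTED MEAN ACTION STRICTLY DECREASING, EVERY `N ≥ 2`, EVERY REAL `β`:
# `Var_β(Re tr(1−V)) > 0` (row NE7b, node U5c; MODEL, [folklore]; census V57)

Cell `pub-balaban-gaps` (G2 spine census) for the `pub-balaban` T⁴ crux NE7b (`T4WeightBudget.RelWeightBound`; NOT PRINTED, NOT PROVED).  Crux-route work under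
`Spine/NE7b/`; imports the landed V56 `CompactFibreMeanActionSUNDeriv` (`integral_sq_sub_mul_exp_eq`, `hasDerivAt_meanAction_SUN`; it re-exports V50
`CompactFibreMeanActionSUNMonotone` — `plaquetteMass_SUN_pos_real`, `hasDerivAt_freeEnergy_SUN`, `meanAction_zero` — and V46's `continuous_re_trace_one_sub`,
`integral_re_trace_one_sub_haar_SUN`) + Mathlib (`IsOpen.measure_pos` for the Haar measure, `integral_pos_iff_support_of_nonneg`, `strictAnti_of_deriv_neg`,
`StrictAnti.strictConcaveOn_univ_of_deriv`, `StrictConcaveOn.slope_lt_of_hasDerivAt` ∕ `lt_slope_of_hasDerivAt`); no `def`, zero `sorry`, nothing of Bałaban's asserted.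

THE LOCATED QUESTION.  V50 proved `⟨s⟩_β` antitone and `−log Z_N` concave on `[0, ∞)`; V56 extended both to all of ℝ through `⟨s⟩_β′ = −Var_β(s) ≤ 0`
(`s = Re tr(1−V)`, one `SU(N)` plaquette under Haar).  QUESTION (V57): are they STRICT — is the variance of the action under the tilted weight ever zero?
ANSWER ([folklore]; `N ≥ 2`; `Z, M, W` the tilted zeroth ∕ first ∕ second moments):
* §1 **`re_trace_one_sub_one`** (`s(1) = 0`), **`exists_re_trace_one_sub_ne`**: for every `c` some `V ∈ SU(N)` has `s(V) ≠ c` (else `s ≡ s(1) = 0`, contradicting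
  V46's `∫ s dHaar = N`) — the action is NOT constant;
* §2 **`integral_sq_sub_mul_exp_pos`**: `0 < ∫ (s − c)²·e^{−βs} dHaar` for every real `β, c` — the integrand is continuous, nonnegative and nonzero on the
  nonempty OPEN set `{s ≠ c}`, which has positive Haar measure (`IsOpenPosMeasure` of the Haar measure on the compact group);
* §3 **`actionVariance_SUN_pos`**: `0 < W∕Z − (M∕Z)²` (§2 at `c = M∕Z` with V56's expansion `∫(s − c)²e^{−βs} = W − 2cM + c²Z`);
  **`deriv_meanAction_SUN_neg`**, **`meanAction_SUN_strictAnti : StrictAnti (β ↦ ⟨s⟩_β)`** on all of ℝ; **`meanAction_lt`**: `⟨s⟩_β < N` for `β > 0`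
  (V50's `meanAction_le` made strict) and **`lt_meanAction`**: `N < ⟨s⟩_β` for `β < 0`;
* §4 **`freeEnergy_SUN_strictConcaveOn_univ : StrictConcaveOn ℝ univ (β ↦ −log Z_N(β))`** and **`log_plaquetteMass_SUN_strictConvexOn_univ`** (`Z_N` strictly
  log-convex on ℝ).
* §5 **`freeEnergy_SUN_lt_tangent`**: `−log Z_N(β) < −log Z_N(β₀) + ⟨s⟩_{β₀}(β − β₀)` for all real `β ≠ β₀` (the free energy lies STRICTLY below each
  tangent — V49's tangent-line Jensen inequality made strict); at `β₀ = 0`: **`freeEnergy_SUN_lt`** (`−log Z_N(β) < Nβ`, `β ≠ 0` — V50's `freeEnergy_SUN_le` strict)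
  and **`exp_neg_lt_plaquetteMass_SUN`** (`e^{−Nβ} < Z_N(β)`, `β ≠ 0` — V46's tangent floor strict).

HONEST REMARKS.  (i) MODEL ∕ [folklore]: Haar calculus of ONE `SU(N)` plaquette variable — the compact-fibre carrier's product REFERENCE state, NOT the interacting
measure.  (ii) No constants: strictness only (a quantitative lower bound on `Var_β` uniform on compact `β`-ranges would follow from continuity but is not
stated).  (iii) (A3) ∕ (A1c) NOT asserted; NC-NE7b-α UNRULED.  BY-NAME EFFECT ON THE WALL: NONE.  NE7b NOT PRINTED ∕ NOT PROVED; spine PROVED 0∕9; rung (B)+1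
on ONE finite T⁴ — NOT infinite volume, NOT the mass gap, NOT Clay.
HONEST DEPENDENCY: continuum YM on T⁴ ⇐ BetaPertH ∧ nine spine estimates (0/9 proved); BetaPertH ⇐ (D1) ∧ (D4) ∧ CAP+tail;
G-an2-4 gates asym, D1 and NE2/3/4.  This file changes none of it.
-/

set_option autoImplicit false

noncomputable section

open Real Set MeasureTheory Filter Topology
open Literature.MathematicalPhysics.QuantumFieldTheory (haarProbability)
open Summit.QuantumFields.BalabanUV.T4Continuum.NE7b.CompactFibreHalvedActionSUN (measurable_re_trace_one_sub re_trace_one_sub_le_two_mul)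
open Summit.QuantumFields.BalabanUV.T4Continuum.NE7b.CompactFibreProfileVolumeSUN (re_trace_one_sub_nonneg)
open Summit.QuantumFields.BalabanUV.T4Continuum.NE7b.CompactFibrePlaquetteMassSUNTangentFloor (continuous_re_trace_one_sub integral_re_trace_one_sub_haar_SUN)
open Summit.QuantumFields.BalabanUV.T4Continuum.NE7b.CompactFibreMeanActionSUNMonotone (plaquetteMass_SUN_pos_real hasDerivAt_freeEnergy_SUN meanAction_zero)
open Summit.QuantumFields.BalabanUV.T4Continuum.NE7b.CompactFibreMeanActionSUNDeriv (integral_sq_sub_mul_exp_eq hasDerivAt_meanAction_SUN)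

namespace Summit.QuantumFields.BalabanUV.T4Continuum.NE7b.CompactFibreFreeEnergySUNStrict

variable {N : ℕ}

/-! ### §1 The action is not constant -/

/-- `Re tr(1 − 1) = 0` on `SU(N)`. [folklore] -/
theorem re_trace_one_sub_one :
    (Matrix.trace (1 - ((1 : Matrix.specialUnitaryGroup (Fin N) ℂ) : Matrix (Fin N) (Fin N) ℂ))).re = 0 := by
  simp only [OneMemClass.coe_one, sub_self, Matrix.trace_zero, Complex.zero_re]

/-- **THE ACTION IS NOT CONSTANT ON `SU(N)`, `N ≥ 2`**: for every real `c` there is `V` with `Re tr(1 − V) ≠ c` (otherwise `Re tr(1 − V) ≡ Re tr(1 − 1) = 0`,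
contradicting V46's `∫ Re tr(1 − V) dHaar = N`). [folklore] -/
theorem exists_re_trace_one_sub_ne (hN : 2 ≤ N) (c : ℝ) :
    ∃ V : Matrix.specialUnitaryGroup (Fin N) ℂ, (Matrix.trace (1 - (V : Matrix (Fin N) (Fin N) ℂ))).re ≠ c := by
  by_contra h
  push Not at h
  have h1 := h 1
  rw [re_trace_one_sub_one] at h1
  have hint := integral_re_trace_one_sub_haar_SUN hN
  have hfun : (fun V : Matrix.specialUnitaryGroup (Fin N) ℂ => (Matrix.trace (1 - (V : Matrix (Fin N) (Fin N) ℂ))).re) = fun _ => c := funext h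
  rw [hfun, integral_const, smul_eq_mul, probReal_univ, one_mul, ← h1] at hint
  have hN' : (0 : ℝ) < N := by exact_mod_cast (lt_of_lt_of_le (by norm_num) hN)
  linarith

/-! ### §2 The centred second moment under the tilted weight is positive -/

/-- **`0 < ∫ (Re tr(1−V) − c)²·e^{−β Re tr(1−V)} dHaar_{SU(N)}`** for every real `β, c` (`N ≥ 2`): the integrand is continuous, nonnegative, and nonzero on
the nonempty open set `{Re tr(1−V) ≠ c}`, which has positive Haar measure. [folklore] -/
theorem integral_sq_sub_mul_exp_pos (hN : 2 ≤ N) (β c : ℝ) :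
    0 < ∫ V, ((Matrix.trace (1 - (V : Matrix (Fin N) (Fin N) ℂ))).re - c) ^ 2 * Real.exp (-(β * (Matrix.trace (1 - (V : Matrix (Fin N) (Fin N) ℂ))).re))
      ∂(haarProbability (Matrix.specialUnitaryGroup (Fin N) ℂ)) := by
  haveI : (haarProbability (Matrix.specialUnitaryGroup (Fin N) ℂ)).IsHaarMeasure := Measure.isHaarMeasure_haarMeasure ⊤
  have hs := continuous_re_trace_one_sub (N := N)
  have hcont : Continuous fun V : Matrix.specialUnitaryGroup (Fin N) ℂ =>
      ((Matrix.trace (1 - (V : Matrix (Fin N) (Fin N) ℂ))).re - c) ^ 2 * Real.exp (-(β * (Matrix.trace (1 - (V : Matrix (Fin N) (Fin N) ℂ))).re)) :=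
    ((hs.sub continuous_const).pow 2).mul (Real.continuous_exp.comp (continuous_const.mul hs).neg)
  have hnn : 0 ≤ fun V : Matrix.specialUnitaryGroup (Fin N) ℂ =>
      ((Matrix.trace (1 - (V : Matrix (Fin N) (Fin N) ℂ))).re - c) ^ 2 * Real.exp (-(β * (Matrix.trace (1 - (V : Matrix (Fin N) (Fin N) ℂ))).re)) :=
    fun V => mul_nonneg (sq_nonneg _) (Real.exp_pos _).le
  have hint : Integrable (fun V : Matrix.specialUnitaryGroup (Fin N) ℂ =>
      ((Matrix.trace (1 - (V : Matrix (Fin N) (Fin N) ℂ))).re - c) ^ 2 * Real.exp (-(β * (Matrix.trace (1 - (V : Matrix (Fin N) (Fin N) ℂ))).re)))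
      (haarProbability (Matrix.specialUnitaryGroup (Fin N) ℂ)) :=
    hcont.integrable_of_hasCompactSupport (HasCompactSupport.of_compactSpace _)
  rw [integral_pos_iff_support_of_nonneg hnn hint]
  obtain ⟨V₀, hV₀⟩ := exists_re_trace_one_sub_ne hN c
  have hopen : IsOpen {V : Matrix.specialUnitaryGroup (Fin N) ℂ | (Matrix.trace (1 - (V : Matrix (Fin N) (Fin N) ℂ))).re ≠ c} :=
    isOpen_ne_fun hs continuous_const
  have hsub : {V : Matrix.specialUnitaryGroup (Fin N) ℂ | (Matrix.trace (1 - (V : Matrix (Fin N) (Fin N) ℂ))).re ≠ c}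
      ⊆ Function.support (fun V : Matrix.specialUnitaryGroup (Fin N) ℂ =>
        ((Matrix.trace (1 - (V : Matrix (Fin N) (Fin N) ℂ))).re - c) ^ 2 * Real.exp (-(β * (Matrix.trace (1 - (V : Matrix (Fin N) (Fin N) ℂ))).re))) := by
    intro V hV
    rw [Function.mem_support]
    exact mul_ne_zero (pow_ne_zero 2 (sub_ne_zero.2 hV)) (Real.exp_pos _).ne'
  exact (hopen.measure_pos (haarProbability (Matrix.specialUnitaryGroup (Fin N) ℂ)) ⟨V₀, hV₀⟩).trans_le (measure_mono hsub)

/-! ### §3 The variance is positive; the tilted mean action is strictly decreasing -/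

/-- **THE VARIANCE OF THE ACTION UNDER THE TILTED WEIGHT IS POSITIVE, EVERY `N ≥ 2`, EVERY REAL `β`**: `0 < W∕Z − (M∕Z)²` (§2 at `c = M∕Z` with V56's
expansion `∫(s − c)²e^{−βs} = W − 2cM + c²Z`; V56's `actionVariance_SUN_nonneg` made strict). [folklore] -/
theorem actionVariance_SUN_pos (hN : 2 ≤ N) (β : ℝ) :
    0 < (∫ V, (Matrix.trace (1 - (V : Matrix (Fin N) (Fin N) ℂ))).re ^ 2 * Real.exp (-(β * (Matrix.trace (1 - (V : Matrix (Fin N) (Fin N) ℂ))).re))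
          ∂(haarProbability (Matrix.specialUnitaryGroup (Fin N) ℂ)))
        / (∫ V, Real.exp (-(β * (Matrix.trace (1 - (V : Matrix (Fin N) (Fin N) ℂ))).re)) ∂(haarProbability (Matrix.specialUnitaryGroup (Fin N) ℂ)))
      - ((∫ V, (Matrix.trace (1 - (V : Matrix (Fin N) (Fin N) ℂ))).re * Real.exp (-(β * (Matrix.trace (1 - (V : Matrix (Fin N) (Fin N) ℂ))).re))
            ∂(haarProbability (Matrix.specialUnitaryGroup (Fin N) ℂ)))
          / ∫ V, Real.exp (-(β * (Matrix.trace (1 - (V : Matrix (Fin N) (Fin N) ℂ))).re)) ∂(haarProbability (Matrix.specialUnitaryGroup (Fin N) ℂ))) ^ 2 := by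
  have hZ := plaquetteMass_SUN_pos_real (N := N) β
  set Z := ∫ V, Real.exp (-(β * (Matrix.trace (1 - (V : Matrix (Fin N) (Fin N) ℂ))).re)) ∂(haarProbability (Matrix.specialUnitaryGroup (Fin N) ℂ)) with hZdef
  set M := ∫ V, (Matrix.trace (1 - (V : Matrix (Fin N) (Fin N) ℂ))).re * Real.exp (-(β * (Matrix.trace (1 - (V : Matrix (Fin N) (Fin N) ℂ))).re))
    ∂(haarProbability (Matrix.specialUnitaryGroup (Fin N) ℂ)) with hMdef
  set W := ∫ V, (Matrix.trace (1 - (V : Matrix (Fin N) (Fin N) ℂ))).re ^ 2 * Real.exp (-(β * (Matrix.trace (1 - (V : Matrix (Fin N) (Fin N) ℂ))).re))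
    ∂(haarProbability (Matrix.specialUnitaryGroup (Fin N) ℂ)) with hWdef
  have hpos := integral_sq_sub_mul_exp_pos hN β (M / Z)
  rw [integral_sq_sub_mul_exp_eq (haarProbability (Matrix.specialUnitaryGroup (Fin N) ℂ)) measurable_re_trace_one_sub
    re_trace_one_sub_nonneg (re_trace_one_sub_le_two_mul (N := N)) β (M / Z)] at hpos
  rw [← hZdef, ← hMdef, ← hWdef] at hpos
  have e : W / Z - (M / Z) ^ 2 = (W - 2 * (M / Z) * M + (M / Z) ^ 2 * Z) / Z := by
    field_simp
    ring
  rw [e]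
  exact div_pos hpos hZ

/-- **`d∕dβ ⟨Re tr(1−V)⟩_β < 0`** at every real `β`, every `N ≥ 2` (V56's `hasDerivAt_meanAction_SUN` with the positive variance). [folklore] -/
theorem deriv_meanAction_SUN_neg (hN : 2 ≤ N) (β : ℝ) :
    deriv (fun b : ℝ =>
        (∫ V, (Matrix.trace (1 - (V : Matrix (Fin N) (Fin N) ℂ))).re * Real.exp (-(b * (Matrix.trace (1 - (V : Matrix (Fin N) (Fin N) ℂ))).re))
            ∂(haarProbability (Matrix.specialUnitaryGroup (Fin N) ℂ)))
          / ∫ V, Real.exp (-(b * (Matrix.trace (1 - (V : Matrix (Fin N) (Fin N) ℂ))).re)) ∂(haarProbability (Matrix.specialUnitaryGroup (Fin N) ℂ))) β < 0 := by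
  rw [(hasDerivAt_meanAction_SUN (N := N) β).deriv]
  have h := actionVariance_SUN_pos hN β
  linarith

/-- **THE TILTED MEAN ACTION IS STRICTLY DECREASING ON ALL OF ℝ, EVERY `N ≥ 2`** (V56's `meanAction_SUN_antitone` made strict). [folklore] -/
theorem meanAction_SUN_strictAnti (hN : 2 ≤ N) :
    StrictAnti (fun b : ℝ =>
        (∫ V, (Matrix.trace (1 - (V : Matrix (Fin N) (Fin N) ℂ))).re * Real.exp (-(b * (Matrix.trace (1 - (V : Matrix (Fin N) (Fin N) ℂ))).re))
            ∂(haarProbability (Matrix.specialUnitaryGroup (Fin N) ℂ)))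
          / ∫ V, Real.exp (-(b * (Matrix.trace (1 - (V : Matrix (Fin N) (Fin N) ℂ))).re)) ∂(haarProbability (Matrix.specialUnitaryGroup (Fin N) ℂ))) :=
  strictAnti_of_deriv_neg fun b => deriv_meanAction_SUN_neg hN b

/-- **`⟨Re tr(1−V)⟩_β < N` FOR `β > 0`** (`N ≥ 2`; V50's `meanAction_le` made strict: `⟨s⟩₀ = N` and `⟨s⟩` strictly decreasing). [folklore] -/
theorem meanAction_lt (hN : 2 ≤ N) {β : ℝ} (hβ : 0 < β) :
    (∫ V, (Matrix.trace (1 - (V : Matrix (Fin N) (Fin N) ℂ))).re * Real.exp (-(β * (Matrix.trace (1 - (V : Matrix (Fin N) (Fin N) ℂ))).re))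
          ∂(haarProbability (Matrix.specialUnitaryGroup (Fin N) ℂ)))
        / ∫ V, Real.exp (-(β * (Matrix.trace (1 - (V : Matrix (Fin N) (Fin N) ℂ))).re)) ∂(haarProbability (Matrix.specialUnitaryGroup (Fin N) ℂ)) < N := by
  have h := meanAction_SUN_strictAnti hN hβ
  have h0 := meanAction_zero (N := N) hN
  simp only at h
  rw [h0] at h
  exact h

/-- **`N < ⟨Re tr(1−V)⟩_β` FOR `β < 0`** (`N ≥ 2`; the anti-ferromagnetic side of the same strict monotonicity). [folklore] -/
theorem lt_meanAction (hN : 2 ≤ N) {β : ℝ} (hβ : β < 0) :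
    (N : ℝ) < (∫ V, (Matrix.trace (1 - (V : Matrix (Fin N) (Fin N) ℂ))).re * Real.exp (-(β * (Matrix.trace (1 - (V : Matrix (Fin N) (Fin N) ℂ))).re))
          ∂(haarProbability (Matrix.specialUnitaryGroup (Fin N) ℂ)))
        / ∫ V, Real.exp (-(β * (Matrix.trace (1 - (V : Matrix (Fin N) (Fin N) ℂ))).re)) ∂(haarProbability (Matrix.specialUnitaryGroup (Fin N) ℂ)) := by
  have h := meanAction_SUN_strictAnti hN hβ
  have h0 := meanAction_zero (N := N) hN
  simp only at h
  rw [h0] at h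
  exact h

/-! ### §4 Strict concavity of the free energy -/

/-- **THE ONE-PLAQUETTE FREE ENERGY `−log Z_N` IS STRICTLY CONCAVE ON ALL OF ℝ, EVERY `N ≥ 2`** (`(−log Z_N)′ = ⟨s⟩` — V50 — is strictly decreasing;
V50's `freeEnergy_SUN_concaveOn` ∕ J5's `freeEnergy_SUN_concaveOn_univ` made strict). [folklore] -/
theorem freeEnergy_SUN_strictConcaveOn_univ (hN : 2 ≤ N) :
    StrictConcaveOn ℝ Set.univ (fun b : ℝ =>
      -Real.log (∫ V, Real.exp (-(b * (Matrix.trace (1 - (V : Matrix (Fin N) (Fin N) ℂ))).re)) ∂(haarProbability (Matrix.specialUnitaryGroup (Fin N) ℂ)))) := by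
  have hderiv := fun b : ℝ => hasDerivAt_freeEnergy_SUN (N := N) b
  have hd : deriv (fun b : ℝ =>
      -Real.log (∫ V, Real.exp (-(b * (Matrix.trace (1 - (V : Matrix (Fin N) (Fin N) ℂ))).re)) ∂(haarProbability (Matrix.specialUnitaryGroup (Fin N) ℂ))))
      = fun b : ℝ =>
        (∫ V, (Matrix.trace (1 - (V : Matrix (Fin N) (Fin N) ℂ))).re * Real.exp (-(b * (Matrix.trace (1 - (V : Matrix (Fin N) (Fin N) ℂ))).re))
            ∂(haarProbability (Matrix.specialUnitaryGroup (Fin N) ℂ)))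
          / ∫ V, Real.exp (-(b * (Matrix.trace (1 - (V : Matrix (Fin N) (Fin N) ℂ))).re)) ∂(haarProbability (Matrix.specialUnitaryGroup (Fin N) ℂ)) :=
    funext fun b => (hderiv b).deriv
  refine StrictAnti.strictConcaveOn_univ_of_deriv (continuous_iff_continuousAt.2 fun b => (hderiv b).continuousAt) ?_
  rw [hd]
  exact meanAction_SUN_strictAnti hN

/-- **`Z_N` IS STRICTLY LOG-CONVEX ON ℝ, EVERY `N ≥ 2`**: `β ↦ log ∫ e^{−β Re tr(1−V)} dHaar_{SU(N)}` is strictly convex. [folklore] -/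
theorem log_plaquetteMass_SUN_strictConvexOn_univ (hN : 2 ≤ N) :
    StrictConvexOn ℝ Set.univ (fun b : ℝ =>
      Real.log (∫ V, Real.exp (-(b * (Matrix.trace (1 - (V : Matrix (Fin N) (Fin N) ℂ))).re)) ∂(haarProbability (Matrix.specialUnitaryGroup (Fin N) ℂ)))) := by
  have h2 := neg_strictConvexOn_iff.2 (freeEnergy_SUN_strictConcaveOn_univ hN)
  have e : (-fun b : ℝ => -Real.log (∫ V, Real.exp (-(b * (Matrix.trace (1 - (V : Matrix (Fin N) (Fin N) ℂ))).re)) ∂(haarProbability (Matrix.specialUnitaryGroup (Fin N) ℂ))))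
      = fun b : ℝ => Real.log (∫ V, Real.exp (-(b * (Matrix.trace (1 - (V : Matrix (Fin N) (Fin N) ℂ))).re)) ∂(haarProbability (Matrix.specialUnitaryGroup (Fin N) ℂ))) := by
    funext b; simp only [Pi.neg_apply, neg_neg]
  rw [e] at h2
  exact h2

/-! ### §5 The free energy lies strictly below each of its tangents -/

/-- **STRICT TANGENT BOUND, EVERY `N ≥ 2`, ALL REAL `β ≠ β₀`**: `−log Z_N(β) < −log Z_N(β₀) + ⟨s⟩_{β₀}·(β − β₀)` — the strictly concave free energy lies strictly
below its tangent at `β₀` (slope `⟨s⟩_{β₀}` by V50's `hasDerivAt_freeEnergy_SUN`; Mathlib's one-sided secant–tangent comparisons for `StrictConcaveOn`).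
V49's tangent-line Jensen inequality `Z_N(β₀ + a) ≥ Z_N(β₀)·e^{−a⟨s⟩_{β₀}}` made strict for `a ≠ 0`. [folklore] -/
theorem freeEnergy_SUN_lt_tangent (hN : 2 ≤ N) {β β₀ : ℝ} (hne : β ≠ β₀) :
    -Real.log (∫ V, Real.exp (-(β * (Matrix.trace (1 - (V : Matrix (Fin N) (Fin N) ℂ))).re)) ∂(haarProbability (Matrix.specialUnitaryGroup (Fin N) ℂ)))
      < -Real.log (∫ V, Real.exp (-(β₀ * (Matrix.trace (1 - (V : Matrix (Fin N) (Fin N) ℂ))).re)) ∂(haarProbability (Matrix.specialUnitaryGroup (Fin N) ℂ)))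
        + (∫ V, (Matrix.trace (1 - (V : Matrix (Fin N) (Fin N) ℂ))).re * Real.exp (-(β₀ * (Matrix.trace (1 - (V : Matrix (Fin N) (Fin N) ℂ))).re))
            ∂(haarProbability (Matrix.specialUnitaryGroup (Fin N) ℂ)))
          / (∫ V, Real.exp (-(β₀ * (Matrix.trace (1 - (V : Matrix (Fin N) (Fin N) ℂ))).re)) ∂(haarProbability (Matrix.specialUnitaryGroup (Fin N) ℂ))) * (β - β₀) := by
  have hsc := freeEnergy_SUN_strictConcaveOn_univ hN
  have hd := hasDerivAt_freeEnergy_SUN (N := N) β₀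
  rcases lt_or_gt_of_ne hne with hlt | hgt
  · have h := hsc.lt_slope_of_hasDerivAt (Set.mem_univ β) (Set.mem_univ β₀) hlt hd
    simp only [slope_def_field] at h
    rw [lt_div_iff₀ (sub_pos.2 hlt)] at h
    linarith
  · have h := hsc.slope_lt_of_hasDerivAt (Set.mem_univ β₀) (Set.mem_univ β) hgt hd
    simp only [slope_def_field] at h
    rw [div_lt_iff₀ (sub_pos.2 hgt)] at h
    linarith

/-- **`−log Z_N(β) < N·β` FOR EVERY REAL `β ≠ 0`** (`N ≥ 2`; §5 at `β₀ = 0`, where `Z_N(0) = 1` and `⟨s⟩₀ = N`): V50's `freeEnergy_SUN_le` made strict. [folklore] -/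
theorem freeEnergy_SUN_lt (hN : 2 ≤ N) {β : ℝ} (hβ : β ≠ 0) :
    -Real.log (∫ V, Real.exp (-(β * (Matrix.trace (1 - (V : Matrix (Fin N) (Fin N) ℂ))).re)) ∂(haarProbability (Matrix.specialUnitaryGroup (Fin N) ℂ))) < N * β := by
  have h := freeEnergy_SUN_lt_tangent hN (β₀ := 0) hβ
  rw [meanAction_zero hN] at h
  have hZ0 : (∫ V, Real.exp (-((0 : ℝ) * (Matrix.trace (1 - (V : Matrix (Fin N) (Fin N) ℂ))).re)) ∂(haarProbability (Matrix.specialUnitaryGroup (Fin N) ℂ))) = 1 := by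
    simp only [zero_mul, neg_zero, Real.exp_zero, integral_const, probReal_univ, one_smul]
  rw [hZ0, Real.log_one, neg_zero, zero_add, sub_zero] at h
  exact h

/-- **`e^{−Nβ} < Z_N(β)` FOR EVERY REAL `β ≠ 0`** (`N ≥ 2`): V46's tangent floor `Z_N(β) ≥ e^{−Nβ}` is strict off `β = 0`. [folklore] -/
theorem exp_neg_lt_plaquetteMass_SUN (hN : 2 ≤ N) {β : ℝ} (hβ : β ≠ 0) :
    Real.exp (-((N : ℝ) * β)) < ∫ V, Real.exp (-(β * (Matrix.trace (1 - (V : Matrix (Fin N) (Fin N) ℂ))).re)) ∂(haarProbability (Matrix.specialUnitaryGroup (Fin N) ℂ)) := by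
  have hZ := plaquetteMass_SUN_pos_real (N := N) β
  have h := freeEnergy_SUN_lt hN hβ
  exact (Real.lt_log_iff_exp_lt hZ).1 (by linarith)

end Summit.QuantumFields.BalabanUV.T4Continuum.NE7b.CompactFibreFreeEnergySUNStrict

end
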